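/-
Copyright (c) 2026 the pub-hodgecm-mathlib formalisation cell (harness21).  Prover seat hodgecm-mathlib-LH7-p08 (g0) (re-dealt to strike line L3 `stub_N6nsDyadic` by director
s1969 (a)), Track A «(D-RAM) FOUR-FRAME» squad, helper lane on h413 = stmt-HodgeConjecture-24833 (count-neutral).  β-BOARD v1 row R8 ∕ (P5) «H `(2ρ,2ρ,2ρ)`», FILE 2b: the
class-sign sum of the labelled-odd count on the orbit representative `V_H(1,1,g)`, with the two-slot `lam` made explicit.  2026-09-04.
-/
import Summits.HodgeConjecture.HodgeConjecture.Theorems.F0P3cDyRamTwoSlotLabelReadCoreHanging         -- ★ p861388 (this seat, FILE 2a): `valueClassLabel_coreHanging_rep_class_iff_normSign`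
import Summits.HodgeConjecture.HodgeConjecture.Theorems.F0P3cDyRamLabelledOddClassSignSubgroup           -- ★ p860847 (LH4-p13 (g8), (L-lab-20d)): `two_mul_card_mul_labelledOddCount_eq_sum_of_classSign`
import Summits.HodgeConjecture.HodgeConjecture.Theorems.F0P3cDyRamDiagonalOrbitFibreTransport            -- ★ (F0P3-p01): `fibre_isCoset_zero` (the type-0 fibre is one `S_F`-coset)
import Summits.HodgeConjecture.HodgeConjecture.Theorems.F0P3cDyRamValueClassLabelEquivariant            -- ★ p860316 (LH4-p11 (g8)): `isTorusEquivariantLabel_valueClassLabel`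
import Summits.HodgeConjecture.HodgeConjecture.Theorems.F0P3cDyRamDiagonalKappaCountEval                 -- ★ Fκ2: `fixed_of_mem_fixedUnitStabilizer`
import Literature.NumberTheory.LocalFields.WildQuadraticDatumNormSignConductor                           -- ★ toolkit: `exists_nonnorm_dichotomy`
import Summits.HodgeConjecture.HodgeConjecture.Theorems.F0P3cDyRamStableSumSignClasses                  -- ★ (LH4-p11): `normSign_eq_one_or` (`ω ∈ {±1}`)
import HarnessLib

/-!
# Crux `H413`, line LH4 «(D-RAM) FOUR-FRAME» — (β) table, β-BOARD row R8 ∕ (P5), FILE 2b: «THE CLASS-SIGN SUM OF THE LABELLED-ODD COUNT ON `V_H(1,1,g)`» —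
# `2·[N′:N₀]·m^Λ_i(V_H) = ω(D(g)_i) · Σ_{r ∈ R₀} ω(r_i)·(1 + ω(r₀·g·g_α + r₁·g_β))` for every subgroup `N₀ ≤ N′` and transversal `R₀` of `S_F ∕ N₀`

Cell `hodgecm-mathlib` (D-0151), FLOOR 0, crux item H413 = `stmt-HodgeConjecture-24833`, route `HCCMUnconditional`; squad F0∕P3c∕LH4.  THEOREMS ONLY (no `def`, no instance, no
notation, no `sorry`, default heartbeats); ★-only imports; lane `--supports stmt-HodgeConjecture-24833 --as helper` (count-neutral); pays NO row, states NO law.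

WHY (this seat's H-ROW DERIVATION v1 e4da7f0103cc4a29 §2, step «★ p860847 over the t = 0 product transversal»).  On the core-hanging orbit representative
`V_H(1,1,g) = latt(1 0 0; 1 ϖ^ρ 0; 1+g ϖ^ρ ϖ^{2ρ})` (`g` a σ-fixed UNIT, `|1+g| = 1`, `ρ ≥ 1`) with its ★ κH (A1) polarisation `D(g) = π₀^{−ρ}·(g, 1, −(1+g)⁻¹)`, LH4-p13's ★ class-sign
count (L-lab-20d) `two_mul_card_mul_labelledOddCount_eq_sum_of_classSign` applies with: `hcoset` = ★ `fibre_isCoset_zero` (normalised, ★ B7 (iv) (C)); the label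
`Λ = valueClassLabel σ ϖ (α−1) (β−1) m* d` and `lam u := ±1` its sign on the class `D(g)·u`, `N′`-INVARIANT because the label is torus-equivariant (★ p860316) and `N′ = N(S̃(V_H))`
consists of norms of STABILISING units; and FILE 2a ★ p861388 reads `lam r = ω(r₀·g·g_α + r₁·g_β)` on every `r ∈ S_F` (two-slot regime: fixed approximants `g_α, g_β` to precision
`ϖ^{m*}` after the weight `π₀^{−ρ}`).  RESULT (§2 HEAD `two_mul_card_mul_labelledOddCount_coreHanging_rep_eq`): for EVERY subgroup `N₀ ≤ N′` with a transversal `R₀` of `S_F ∕ N₀` (and a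
transversal `R` of `S_F ∕ N′`, as in ★ p860847):  `2·#(R₀ ∩ N′)·m^Λ_i(V_H) = ω(D(g)_i)·Σ_{r ∈ R₀} ω(r_i)·(1 + ω(r₀·g·g_α + r₁·g_β))`.  With ★ PT `productTransversal_glued_rep` at
`t = 0` (`R₀ = {a₀(1,ψ,ψy)}`, `N₀` = the product norm subgroup, ★ (PT-1)) the a₀-sum kills the κ part: `Σ_{R₀} = 2·Σ_{y,aγ} X_i·ω(g·g_α + ψ·g_β)` — FILE 2c's character sums
(LH7-p07 (g0) SIG-R7-CharSums (s0)(s1)(s2) currency, `h = g·g_α∕g_β`).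
* §1 `lam`-bookkeeping: the `N′`-invariance `valueClassLabel_mul_norm_iff_of_mem_unitStabilizer` (`ω ∈ {±1}` is ★ `normSign_eq_one_or`).
* §2 HEAD.
HONEST LABEL.  Count-neutral (`--supports`); FILE 2c (character sums), the stratum assembly, the R8 value, `hRest`, (T3), (β-BAL), (β), T₊ stay OPEN; `HC_CM` is proved only modulo
the 7 printed citations (2 remaining named inputs: hLiu418 = `stmt-HodgeConjecture-24832`, h413 = `stmt-HodgeConjecture-24833`) until rung 0 closes.

## References
* [Kottwitz1986BaseChangeUnits] R. E. Kottwitz, *Base change for unit elements of Hecke algebras*, Compositio Math. 60 (1986), §1 pp. 240–241 (signed lattice counts modulo the torus).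
* [LanglandsShelstad1987] R. P. Langlands, D. Shelstad, *On the definition of transfer factors*, Math. Ann. 278 (1987), §3 (the characters of `H¹(F, T)`).
* [Rogawski1990] J. D. Rogawski, *Automorphic Representations of Unitary Groups in Three Variables*, Ann. of Math. Stud. 123 (1990), §4.9 Prop. 4.9.1 (a)(b) p. 55.
* [Serre1979] J.-P. Serre, *Local Fields*, GTM 67 (1979), Ch. V §3 Cor. 3.
-/

set_option autoImplicit false

noncomputable section

namespace Summit.HodgeConjecture.HodgeConjecture.Cruxes.H413.F0P3cDyRamLabelledOddCoreHangingClassSum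

open Literature.NumberTheory.Automorphic Literature.NumberTheory.Automorphic.HermitianLattice Literature.NumberTheory.Automorphic.UnitaryGroup
open Literature.NumberTheory.Automorphic.UnitaryLatticeTree Literature.NumberTheory.Automorphic.UnitaryThreeFourFrame
open Literature.NumberTheory.LocalFields Literature.NumberTheory.LocalFields.WildQuadraticDatum
open Summit.HodgeConjecture.HodgeConjecture.Cruxes.H413.F0P3cDyRamFourFramePieces
open Summit.HodgeConjecture.HodgeConjecture.Cruxes.H413.F0P3cDyRamFourFrameCensusDefs
open Summit.HodgeConjecture.HodgeConjecture.Cruxes.H413.F0P3cDyRamDiagonalTorusDefs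
open Summit.HodgeConjecture.HodgeConjecture.Cruxes.H413.F0P3cDyRamLabelledOddCountDefs
open Summit.HodgeConjecture.HodgeConjecture.Cruxes.H413.F0P3cDyRamTwoSlotLabelReadCoreHanging (valueClassLabel_coreHanging_rep_class_iff_normSign)
open Summit.HodgeConjecture.HodgeConjecture.Cruxes.H413.F0P3cDyRamLabelledOddClassSignSubgroup (two_mul_card_mul_labelledOddCount_eq_sum_of_classSign)
open Summit.HodgeConjecture.HodgeConjecture.Cruxes.H413.F0P3cDyRamDiagonalOrbitFibreTransport (fibre_isCoset_zero)
open Summit.HodgeConjecture.HodgeConjecture.Cruxes.H413.F0P3cDyRamValueClassLabelEquivariant (isTorusEquivariantLabel_valueClassLabel)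
open Summit.HodgeConjecture.HodgeConjecture.Cruxes.H413.F0P3cDyRamDiagonalKappaCountEval (fixed_of_mem_fixedUnitStabilizer)
open Summit.HodgeConjecture.HodgeConjecture.Cruxes.H413.F0P3cDyRamDiagonalCoreHangingCount (isNormalisedLattice_latt_coreHanging)
open Summit.HodgeConjecture.HodgeConjecture.Cruxes.H413.F0P3cDyRamStableSumSignClasses (normSign_eq_one_or)
open scoped Valued WithZero Matrix MatrixGroups
open WithZero

variable {K : Type} [Field K] [Valued K ℤᵐ⁰]

/-! ## §1  `lam`-bookkeeping: the label is invariant under norms of stabilising units (`ω ∈ {±1}` is ★ `normSign_eq_one_or`) -/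

/-- **THE VALUE-CLASS LABEL IS `N(S̃)`-INVARIANT IN THE FORM**: for `n = N(s)`, `s` a unit diagonal STABILISER of `M`, and any form `D`,
`Λ(M, D·n) ↔ Λ(M, D)` (`Λ = valueClassLabel σ ϖ x₀ x₁ m d`) — torus-equivariance ★ p860316 (`Λ(diag(s)M, D) ↔ Λ(M, D·N(s))`) and `diag(s)·M = M`.
[cite: Kottwitz1986BaseChangeUnits, §1 pp. 240–241] [cite: Rogawski1990, §4.9 Prop. 4.9.1 (b) p. 55] -/
theorem valueClassLabel_mul_norm_iff_of_mem_unitStabilizer (σ : K →+* K) (ϖ x₀ x₁ : K) (m d : ℕ) {M : Submodule 𝒪[K] (Fin 3 → K)}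
    {n : Fin 3 → Kˣ} (hn : n ∈ (unitStabilizer M).map (unitNormMap σ 3)) (D : Fin 3 → K) :
    valueClassLabel σ ϖ x₀ x₁ m d M (fun j => D j * ((n j : Kˣ) : K)) ↔ valueClassLabel σ ϖ x₀ x₁ m d M D := by
  obtain ⟨s, hs, rfl⟩ := Subgroup.mem_map.1 hn
  have hstab : mapGL (diagGLUnits s) M = M := ((mem_unitStabilizer_iff M s).1 hs).1
  have h := isTorusEquivariantLabel_valueClassLabel σ ϖ x₀ x₁ m d s M D
  rw [hstab] at h
  simp only [unitNormMap_apply]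
  exact h.symm

/-! ## §2  HEAD — the class-sign sum on `V_H(1,1,g)` with the two-slot `lam` -/

open Classical in
/-- **THE CLASS-SIGN SUM OF THE LABELLED-ODD COUNT ON `V_H(1,1,g)`, TWO-SLOT `lam` EXPLICIT.**  Frame: a ramified datum on a complete field with finite residue field;
`V_H = [[1,0,0],[1,ϖ^ρ,0],[1+g,ϖ^ρ,ϖ^{2ρ}]]` (`ρ ≥ 1`, `g` σ-fixed, `g ≠ 0`, `|1+g| = 1`), its polarisation `D(g) = π₀^{−ρ}(g, 1, −(1+g)⁻¹)` a type-0 form of `latt V_H` (★ κH (A1),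
hypothesis `hV₁`); element datum `hE`, the clean-shell tokens and `T`-stability of `latt V_H` (hypotheses; on `H(ρ)` they read `2ρ + ℓ₀ = min(n₁,n₂)`, ★ p861362); fixed approximants
`g_α, g_β` with `|ϖ^{−m*}·π₀^{−ρ}·((α−1) − g_α t₊)| ≤ 1`, `|ϖ^{−m*}·π₀^{−ρ}·((β−1) − g_β t₊)| ≤ 1`; a transversal `R` of `S_F ∕ N′` (`N′ = N(S̃(latt V_H))`), a subgroup `N₀ ≤ N′` and a
transversal `R₀` of `S_F ∕ N₀` (★ p860847's Finset ∃!-currency).  THEN, with `Λ = valueClassLabel σ ϖ (α−1) (β−1) m* d`: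
`2 · #(R₀ ∩ N′) · labelledOddCount σ ϖ 0 i Λ (latt V_H) = ω(D(g)_i) · Σ_{r ∈ R₀} ω(r_i) · (1 + ω(r₀·g·g_α + r₁·g_β))`.
[cite: Kottwitz1986BaseChangeUnits, §1 pp. 240–241] [cite: LanglandsShelstad1987, §3] [cite: Rogawski1990, §4.9 Prop. 4.9.1 (a)(b) p. 55] -/
theorem two_mul_card_mul_labelledOddCount_coreHanging_rep_eq [CompleteSpace K] [Finite 𝓀[K]] {σ : K →+* K} {ϖ : K} {d t : ℕ} (hDat : IsRamifiedQuadraticDatum σ ϖ d t)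
    {ρ : ℕ} (hρ : 1 ≤ ρ) {g : K} (hσg : σ g = g) (hg0 : g ≠ 0) (h1g : Valued.v (1 + g) = 1)
    (V : GL (Fin 3) K) (hV : (V : Matrix (Fin 3) (Fin 3) K) = !![1, 0, 0; 1, ϖ ^ ρ, 0; 1 * 1 + g, ϖ ^ ρ * 1, ϖ ^ (2 * ρ)])
    (hV₁ : IsVertexLattice σ ϖ (Matrix.diagonal (![((ϖ * σ ϖ) ^ ρ)⁻¹ * g, ((ϖ * σ ϖ) ^ ρ)⁻¹, -(((ϖ * σ ϖ) ^ ρ)⁻¹ * (1 + g)⁻¹)] : Fin 3 → K)) 0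
      (latt (V : Matrix (Fin 3) (Fin 3) K)))
    {α β : K} {N₀' n₁ n₂ n₃ : ℕ} (hE : IsElementDatum σ ϖ N₀' α β n₁ n₂ n₃) {mc : ℕ} (hℓN : d % 2 + 1 ≤ N₀') (hmN : d % 2 + 2 * d - 1 ≤ N₀')
    (hℓmc : 2 * (d % 2) + 1 ≤ mc) (hmmc : d % 2 + 2 * d - 1 + d % 2 ≤ mc)
    (hlev : LatticeInLevel ϖ (d % 2) (Matrix.diagonal ![α - 1, β - 1, 0]) (latt (V : Matrix (Fin 3) (Fin 3) K)))
    (hnlev : ¬ LatticeInLevel ϖ (d % 2 + 1) (Matrix.diagonal ![α - 1, β - 1, 0]) (latt (V : Matrix (Fin 3) (Fin 3) K)))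
    (hsq : LatticeInLevel ϖ mc (Matrix.diagonal ![(α - 1) * (α - 1), (β - 1) * (β - 1), 0]) (latt (V : Matrix (Fin 3) (Fin 3) K)))
    {T : GL (Fin 3) K} (hT : (T : Matrix (Fin 3) (Fin 3) K) = Matrix.diagonal ![α, β, 1]) (hTM : mapGL T (latt (V : Matrix (Fin 3) (Fin 3) K)) = latt (V : Matrix (Fin 3) (Fin 3) K))
    {gα gβ : K} (hσgα : σ gα = gα) (hσgβ : σ gβ = gβ)
    (hgα : Valued.v ((ϖ ^ (d % 2 + 2 * d - 1))⁻¹ * (((ϖ * σ ϖ) ^ ρ)⁻¹ * ((α - 1) - gα * ((ϖ - σ ϖ) * ((ϖ * σ ϖ) ^ ((d - d % 2) / 2))⁻¹)))) ≤ 1)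
    (hgβ : Valued.v ((ϖ ^ (d % 2 + 2 * d - 1))⁻¹ * (((ϖ * σ ϖ) ^ ρ)⁻¹ * ((β - 1) - gβ * ((ϖ - σ ϖ) * ((ϖ * σ ϖ) ^ ((d - d % 2) / 2))⁻¹)))) ≤ 1)
    (i : Fin 3)
    (R : Finset (Fin 3 → Kˣ)) (hRS : ∀ r ∈ R, r ∈ fixedUnitStabilizer σ (latt (V : Matrix (Fin 3) (Fin 3) K)))
    (hR : ∀ u ∈ fixedUnitStabilizer σ (latt (V : Matrix (Fin 3) (Fin 3) K)), ∃! r, r ∈ R ∧ u⁻¹ * r ∈ (unitStabilizer (latt (V : Matrix (Fin 3) (Fin 3) K))).map (unitNormMap σ 3))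
    {N₀ : Subgroup (Fin 3 → Kˣ)} (hN₀ : N₀ ≤ (unitStabilizer (latt (V : Matrix (Fin 3) (Fin 3) K))).map (unitNormMap σ 3))
    (R₀ : Finset (Fin 3 → Kˣ)) (hR₀S : ∀ r ∈ R₀, r ∈ fixedUnitStabilizer σ (latt (V : Matrix (Fin 3) (Fin 3) K)))
    (hR₀ : ∀ u ∈ fixedUnitStabilizer σ (latt (V : Matrix (Fin 3) (Fin 3) K)), ∃! r, r ∈ R₀ ∧ u⁻¹ * r ∈ N₀) :
    2 * ((R₀.filter fun r => r ∈ (unitStabilizer (latt (V : Matrix (Fin 3) (Fin 3) K))).map (unitNormMap σ 3)).card : ℤ) *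
        labelledOddCount σ ϖ 0 i (valueClassLabel σ ϖ (α - 1) (β - 1) (d % 2 + 2 * d - 1) d) (latt (V : Matrix (Fin 3) (Fin 3) K)) =
      normSign σ ((![((ϖ * σ ϖ) ^ ρ)⁻¹ * g, ((ϖ * σ ϖ) ^ ρ)⁻¹, -(((ϖ * σ ϖ) ^ ρ)⁻¹ * (1 + g)⁻¹)] : Fin 3 → K) i) *
        ∑ r ∈ R₀, normSign σ ((r i : Kˣ) : K) * (1 + normSign σ (((r 0 : Kˣ) : K) * g * gα + ((r 1 : Kˣ) : K) * gβ)) := by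
  classical
  obtain ⟨hσ, hvσ, hϖ, -, -, -, -⟩ := id hDat
  have hϖ0 : ϖ ≠ 0 := (Valuation.ne_zero_iff Valued.v).1 (by rw [hϖ]; exact exp_ne_zero)
  have hϖ1 : Valued.v ϖ ≤ 1 := by rw [hϖ, ← exp_zero, exp_le_exp]; norm_num
  have hσϖ0 : σ ϖ ≠ 0 := (map_ne_zero σ).2 hϖ0
  have hπ0 : ((ϖ * σ ϖ) ^ ρ : K) ≠ 0 := pow_ne_zero _ (mul_ne_zero hϖ0 hσϖ0)
  have hσπ : σ ((ϖ * σ ϖ) ^ ρ) = (ϖ * σ ϖ) ^ ρ := by rw [map_pow, map_mul, hσ, mul_comm]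
  have h1g0 : 1 + g ≠ 0 := fun h => by rw [h, map_zero] at h1g; exact zero_ne_one h1g
  have hgle : Valued.v g ≤ 1 := by
    have e : g = (1 + g) + (-1) := by ring
    rw [e]; exact (Valuation.map_add _ _ _).trans (max_le h1g.le (by rw [Valuation.map_neg, map_one]))
  -- the polarisation letters
  set Dg : Fin 3 → K := ![((ϖ * σ ϖ) ^ ρ)⁻¹ * g, ((ϖ * σ ϖ) ^ ρ)⁻¹, -(((ϖ * σ ϖ) ^ ρ)⁻¹ * (1 + g)⁻¹)] with hDgdef
  have hDg0 : Dg 0 = ((ϖ * σ ϖ) ^ ρ)⁻¹ * g := rfl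
  have hDg1 : Dg 1 = ((ϖ * σ ϖ) ^ ρ)⁻¹ := rfl
  have hDg2 : Dg 2 = -(((ϖ * σ ϖ) ^ ρ)⁻¹ * (1 + g)⁻¹) := rfl
  have hDσ : ∀ j, σ (Dg j) = Dg j ∧ Dg j ≠ 0 := fun j => by
    fin_cases j
    · show σ (Dg 0) = Dg 0 ∧ Dg 0 ≠ 0
      exact ⟨by rw [hDg0, map_mul, map_inv₀, hσπ, hσg], by rw [hDg0]; exact mul_ne_zero (inv_ne_zero hπ0) hg0⟩
    · show σ (Dg 1) = Dg 1 ∧ Dg 1 ≠ 0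
      exact ⟨by rw [hDg1, map_inv₀, hσπ], by rw [hDg1]; exact inv_ne_zero hπ0⟩
    · show σ (Dg 2) = Dg 2 ∧ Dg 2 ≠ 0
      exact ⟨by rw [hDg2, map_neg, map_mul, map_inv₀, map_inv₀, hσπ, map_add, map_one, hσg],
        by rw [hDg2]; exact neg_ne_zero.2 (mul_ne_zero (inv_ne_zero hπ0) (inv_ne_zero h1g0))⟩
  -- normalised, hence the type-0 fibre is ONE `S_F`-coset (★ `fibre_isCoset_zero`)
  have hnorm : IsNormalisedLattice (latt (V : Matrix (Fin 3) (Fin 3) K)) := by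
    rw [hV]
    exact isNormalisedLattice_latt_coreHanging hϖ1 ρ (x := 1) (ζ := 1) (y'' := g) (map_one _) (map_one _) (by rw [one_mul]; exact h1g)
  have hcoset : ∀ D : Fin 3 → K, (∀ j, σ (D j) = D j ∧ D j ≠ 0) →
      (IsVertexLattice σ ϖ (Matrix.diagonal D) 0 (latt (V : Matrix (Fin 3) (Fin 3) K)) ↔
        ∃ u ∈ fixedUnitStabilizer σ (latt (V : Matrix (Fin 3) (Fin 3) K)), ∀ j, D j = Dg j * ((u j : Kˣ) : K)) :=
    fun D hD => fibre_isCoset_zero hvσ ϖ V rfl hnorm Dg hDσ hV₁ D hD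
  -- the dichotomy witness
  obtain ⟨c, hσc, hcn, hdich⟩ := exists_nonnorm_dichotomy hDat
  -- the label and its sign on the classes
  set Λ : Submodule 𝒪[K] (Fin 3 → K) → (Fin 3 → K) → Prop := valueClassLabel σ ϖ (α - 1) (β - 1) (d % 2 + 2 * d - 1) d with hΛdef
  let lam : (Fin 3 → Kˣ) → ℤ := fun u => if Λ (latt (V : Matrix (Fin 3) (Fin 3) K)) (fun j => Dg j * ((u j : Kˣ) : K)) then 1 else -1
  have hlam : ∀ u ∈ fixedUnitStabilizer σ (latt (V : Matrix (Fin 3) (Fin 3) K)), lam u = 1 ∨ lam u = -1 := fun u _ => by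
    simp only [lam]; split_ifs
    · exact Or.inl rfl
    · exact Or.inr rfl
  have hΛlam : ∀ u ∈ fixedUnitStabilizer σ (latt (V : Matrix (Fin 3) (Fin 3) K)),
      Λ (latt (V : Matrix (Fin 3) (Fin 3) K)) (fun j => Dg j * ((u j : Kˣ) : K)) ↔ lam u = 1 := fun u _ => by
    simp only [lam]; split_ifs with h
    · exact ⟨fun _ => rfl, fun _ => h⟩
    · exact ⟨fun h' => absurd h' h, fun h' => absurd h' (by norm_num)⟩
  have hlamN : ∀ u ∈ fixedUnitStabilizer σ (latt (V : Matrix (Fin 3) (Fin 3) K)),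
      ∀ n ∈ (unitStabilizer (latt (V : Matrix (Fin 3) (Fin 3) K))).map (unitNormMap σ 3), lam (u * n) = lam u := fun u _ n hn => by
    have hiff : Λ (latt (V : Matrix (Fin 3) (Fin 3) K)) (fun j => Dg j * (((u * n) j : Kˣ) : K)) ↔
        Λ (latt (V : Matrix (Fin 3) (Fin 3) K)) (fun j => Dg j * ((u j : Kˣ) : K)) := by
      have h := valueClassLabel_mul_norm_iff_of_mem_unitStabilizer σ ϖ (α - 1) (β - 1) (d % 2 + 2 * d - 1) d hn (fun j => Dg j * ((u j : Kˣ) : K))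
      rw [hΛdef]
      refine Iff.trans ?_ h
      simp only [Pi.mul_apply, Units.val_mul, mul_assoc]
    simp only [lam, hiff]
  -- ★ (L-lab-20d)
  have hhead := two_mul_card_mul_labelledOddCount_eq_sum_of_classSign hσc hcn hdich hDσ hV₁ hσ hcoset Λ i hlam hlamN hΛlam R hRS hR hN₀ R₀ hR₀S hR₀
  rw [hΛdef] at hhead
  rw [hhead]
  congr 1
  refine Finset.sum_congr rfl fun r hr => ?_
  -- on `r ∈ R₀ ⊆ S_F`: `lam r = ω(r₀·g·g_α + r₁·g_β)` (FILE 2a)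
  have hrS := hR₀S r hr
  have hfix := fixed_of_mem_fixedUnitStabilizer σ hrS
  have hunit : ∀ j, Valued.v ((r j : Kˣ) : K) = 1 := ((mem_fixedUnitStabilizer_iff σ _ r).1 hrS).2.1
  have hDr : ∀ j, σ (Dg j * ((r j : Kˣ) : K)) = Dg j * ((r j : Kˣ) : K) ∧ Dg j * ((r j : Kˣ) : K) ≠ 0 := fun j =>
    ⟨by rw [map_mul, (hDσ j).1, (hfix j).1], mul_ne_zero (hDσ j).2 (hfix j).2⟩
  have hMr : IsVertexLattice σ ϖ (Matrix.diagonal fun j => Dg j * ((r j : Kˣ) : K)) 0 (latt (V : Matrix (Fin 3) (Fin 3) K)) :=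
    (hcoset _ hDr).2 ⟨r, hrS, fun _ => rfl⟩
  have hgαr : Valued.v ((ϖ ^ (d % 2 + 2 * d - 1))⁻¹ *
      (((ϖ * σ ϖ) ^ ρ)⁻¹ * g * ((r 0 : Kˣ) : K) * ((α - 1) - gα * ((ϖ - σ ϖ) * ((ϖ * σ ϖ) ^ ((d - d % 2) / 2))⁻¹)))) ≤ 1 := by
    have e : (ϖ ^ (d % 2 + 2 * d - 1))⁻¹ * (((ϖ * σ ϖ) ^ ρ)⁻¹ * g * ((r 0 : Kˣ) : K) * ((α - 1) - gα * ((ϖ - σ ϖ) * ((ϖ * σ ϖ) ^ ((d - d % 2) / 2))⁻¹))) =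
        (g * ((r 0 : Kˣ) : K)) * ((ϖ ^ (d % 2 + 2 * d - 1))⁻¹ * (((ϖ * σ ϖ) ^ ρ)⁻¹ * ((α - 1) - gα * ((ϖ - σ ϖ) * ((ϖ * σ ϖ) ^ ((d - d % 2) / 2))⁻¹)))) := by ring
    rw [e, map_mul, map_mul, hunit 0, mul_one]
    exact mul_le_one' hgle hgα
  have hgβr : Valued.v ((ϖ ^ (d % 2 + 2 * d - 1))⁻¹ *
      (((ϖ * σ ϖ) ^ ρ)⁻¹ * ((r 1 : Kˣ) : K) * ((β - 1) - gβ * ((ϖ - σ ϖ) * ((ϖ * σ ϖ) ^ ((d - d % 2) / 2))⁻¹)))) ≤ 1 := by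
    have e : (ϖ ^ (d % 2 + 2 * d - 1))⁻¹ * (((ϖ * σ ϖ) ^ ρ)⁻¹ * ((r 1 : Kˣ) : K) * ((β - 1) - gβ * ((ϖ - σ ϖ) * ((ϖ * σ ϖ) ^ ((d - d % 2) / 2))⁻¹))) =
        ((r 1 : Kˣ) : K) * ((ϖ ^ (d % 2 + 2 * d - 1))⁻¹ * (((ϖ * σ ϖ) ^ ρ)⁻¹ * ((β - 1) - gβ * ((ϖ - σ ϖ) * ((ϖ * σ ϖ) ^ ((d - d % 2) / 2))⁻¹)))) := by ring
    rw [e, map_mul, hunit 1, one_mul]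
    exact hgβ
  have key : Λ (latt (V : Matrix (Fin 3) (Fin 3) K)) (fun j => Dg j * ((r j : Kˣ) : K)) ↔
      normSign σ (((r 0 : Kˣ) : K) * g * gα + ((r 1 : Kˣ) : K) * gβ) = 1 := by
    rw [hΛdef, hDgdef]
    exact valueClassLabel_coreHanging_rep_class_iff_normSign hDat hρ hg0 h1g hσg V hV (u := fun j => ((r j : Kˣ) : K)) (fun j => (hfix j).1)
      (fun j => (hfix j).2) (by rw [← hDgdef]; exact hMr) hE hℓN hmN hℓmc hmmc hlev hnlev hsq hT hTM hσgα hσgβ hgαr hgβr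
  have hlamr : lam r = normSign σ (((r 0 : Kˣ) : K) * g * gα + ((r 1 : Kˣ) : K) * gβ) := by
    rcases normSign_eq_one_or σ (((r 0 : Kˣ) : K) * g * gα + ((r 1 : Kˣ) : K) * gβ) with h1 | h1
    · rw [h1]; exact (hΛlam r hrS).1 (key.2 h1)
    · rw [h1]
      rcases hlam r hrS with h2 | h2
      · exact absurd (key.1 ((hΛlam r hrS).2 h2)) (by rw [h1]; norm_num)
      · exact h2
  rw [hlamr]

end Summit.HodgeConjecture.HodgeConjecture.Cruxes.H413.F0P3cDyRamLabelledOddCoreHangingClassSum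

end
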